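import Mathlib
import Summits.Ventures.PercRepro.TriangleCapTFamily

/-!
# PercRepro — THE COUNTS AROUND A VERTEX OF DEGREE `k − 3`: the neighbours inside a pair, the weighted one-end-per-
matching-edge count, the degree splits, and the two arithmetic certificates of the cap case (p3, gen 43; part 190a)

Tools for part 190b (`three_row_cap`). With `N = N(x)` and `R = {u, v}` the two non-neighbours of a vertex `x` of
degree `k − 3`: `degIn {u, v} y` is two indicators (`degIn_pair`), `Σ_{y ∈ N} g(y)² = Σ_{y ∈ N} g(y) + 2c` with `c`
the vertices of `N` adjacent to both (`sum_degIn_pair_sq`), `c ≤ degIn N u`, `c ≤ degIn N v`, `c ≤ 1` when `u ∼ v`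
(`card_both_le_one_of_adj`); on every matching edge `y y'` of `N` each of `u, v` is adjacent to at most one end
(`not_adj_both`), so `Σ_{y ∈ N} degIn N y · degIn {u, v} y ≤ adjPairs N` (`sum_degIn_mul_degIn_pair_le`); the
degree of `y ∈ N` is `1 + degIn N y + degIn R y` (`deg_eq_of_mem_nbhd`), of `w ∈ R` it is `degIn N w + degIn R w`
(`deg_eq_of_not_mem_nbhd`). The arithmetic: `three_row_cap_arith_not_adj` (the gap is
`2 (min(P_u, P_v) − c) + 2 (αβ − min(α, β)) + (M − 1)(2k − 14 − M)`) and `three_row_cap_arith_adj` (the gap is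
`2 (1 − c) + 2s + 2αβ + (M − 2)(2α + 2β + 2s + M − 1) + 2`). Axioms: standard.
-/

namespace PercRepro

namespace TriangleCap

namespace C047

open Finset

variable {V : Type*} [Fintype V] [DecidableEq V]

omit [Fintype V] in
/-- The neighbours of `y` inside a pair `{u, v}`, as two indicators. -/
theorem degIn_pair (D : SimpleGraph V) [DecidableRel D.Adj] {u v : V} (huv : u ≠ v) (y : V) :
    degIn D {u, v} y = (if D.Adj y u then 1 else 0) + (if D.Adj y v then 1 else 0) := by
  unfold degIn
  rw [filter_insert, filter_singleton]
  by_cases hu : D.Adj y u <;> by_cases hv : D.Adj y v <;> simp [hu, hv, huv]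

omit [Fintype V] in
/-- `degIn {u, v} y ≤ 2`. -/
theorem degIn_pair_le_two (D : SimpleGraph V) [DecidableRel D.Adj] {u v : V} (huv : u ≠ v) (y : V) :
    degIn D {u, v} y ≤ 2 := by
  rw [degIn_pair D huv]
  split_ifs <;> omega

omit [Fintype V] in
/-- `Σ_{y ∈ N} g(y)² = Σ_{y ∈ N} g(y) + 2 c`, `c` the vertices of `N` adjacent to both `u` and `v`. -/
theorem sum_degIn_pair_sq (D : SimpleGraph V) [DecidableRel D.Adj] {u v : V} (huv : u ≠ v) (N : Finset V) :
    ∑ y ∈ N, degIn D {u, v} y * degIn D {u, v} y =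
      ∑ y ∈ N, degIn D {u, v} y + 2 * (N.filter (fun y => D.Adj y u ∧ D.Adj y v)).card := by
  rw [card_filter, mul_sum, ← sum_add_distrib]
  apply sum_congr rfl
  intro y _
  rw [degIn_pair D huv]
  by_cases hu : D.Adj y u <;> by_cases hv : D.Adj y v <;> simp [hu, hv]

omit [Fintype V] [DecidableEq V] in
/-- The vertices of `N` adjacent to both `u` and `v` are among the neighbours of `u` in `N`. -/
theorem card_both_le_degIn (D : SimpleGraph V) [DecidableRel D.Adj] (u v : V) (N : Finset V) :
    (N.filter (fun y => D.Adj y u ∧ D.Adj y v)).card ≤ degIn D N u := by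
  unfold degIn
  apply card_le_card
  intro y hy
  rw [mem_filter] at hy ⊢
  exact ⟨hy.1, D.adj_symm hy.2.1⟩

omit [Fintype V] [DecidableEq V] in
/-- The vertices of `N` adjacent to both `u` and `v` are among the neighbours of `v` in `N`. -/
theorem card_both_le_degIn' (D : SimpleGraph V) [DecidableRel D.Adj] (u v : V) (N : Finset V) :
    (N.filter (fun y => D.Adj y u ∧ D.Adj y v)).card ≤ degIn D N v := by
  unfold degIn
  apply card_le_card
  intro y hy
  rw [mem_filter] at hy ⊢
  exact ⟨hy.1, D.adj_symm hy.2.2⟩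

/-- When `u ∼ v`, at most one vertex of `N` is adjacent to both. -/
theorem card_both_le_one_of_adj (D : SimpleGraph V) [DecidableRel D.Adj] (hK : K4mFree D) {u v : V}
    (huv : D.Adj u v) (N : Finset V) : (N.filter (fun y => D.Adj y u ∧ D.Adj y v)).card ≤ 1 := by
  have h := card_inter_le_one_of_adj D hK huv
  refine le_trans (card_le_card ?_) h
  intro y hy
  rw [mem_filter] at hy
  rw [mem_inter, mem_filter, mem_filter]
  exact ⟨⟨mem_univ y, D.adj_symm hy.2.1⟩, ⟨mem_univ y, D.adj_symm hy.2.2⟩⟩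

/-- **ONE END PER MATCHING EDGE, WEIGHTED:** for `N = N(x)` and `u, v` not in `N ∪ {x}`,
`Σ_{y ∈ N} degIn N y · degIn {u, v} y ≤ adjPairs N`: on a matching edge `y y'` of `N` each of `u, v` is adjacent to
at most one end, so `g(y) + g(y') ≤ 2`. -/
theorem sum_degIn_mul_degIn_pair_le (D : SimpleGraph V) [DecidableRel D.Adj] (hK : K4mFree D) (x u v : V)
    (huv : u ≠ v) (hux : u ≠ x) (hvx : v ≠ x) :
    ∑ y ∈ univ.filter (fun w => D.Adj x w), degIn D (univ.filter (fun w => D.Adj x w)) y * degIn D {u, v} y ≤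
      adjPairs D (univ.filter (fun w => D.Adj x w)) := by
  obtain ⟨N, hN⟩ : ∃ N : Finset V, N = univ.filter (fun w => D.Adj x w) := ⟨_, rfl⟩
  rw [← hN]
  have hmemN : ∀ w, w ∈ N ↔ D.Adj x w := fun w => by rw [hN, mem_filter]; simp only [mem_univ, true_and]
  -- on an edge of `N`, `g(y) + g(y') ≤ 2`
  have hpair : ∀ y ∈ N, ∀ y' ∈ N, D.Adj y y' → degIn D {u, v} y + degIn D {u, v} y' ≤ 2 := by
    intro y hy y' hy' hyy'
    rw [degIn_pair D huv, degIn_pair D huv]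
    have h1 : ¬ (D.Adj y u ∧ D.Adj y' u) := fun h =>
      not_adj_both D hK hyy' (D.adj_symm ((hmemN y).mp hy)) (D.adj_symm ((hmemN y').mp hy')) hux.symm h.1 h.2
    have h2 : ¬ (D.Adj y v ∧ D.Adj y' v) := fun h =>
      not_adj_both D hK hyy' (D.adj_symm ((hmemN y).mp hy)) (D.adj_symm ((hmemN y').mp hy')) hvx.symm h.1 h.2
    have e1 : (if D.Adj y u then 1 else 0) + (if D.Adj y' u then 1 else 0) ≤ 1 := by
      by_cases a1 : D.Adj y u <;> by_cases a2 : D.Adj y' u <;> simp only [a1, a2, if_true, if_false] <;>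
        first | omega | exact absurd ⟨a1, a2⟩ h1
    have e2 : (if D.Adj y v then 1 else 0) + (if D.Adj y' v then 1 else 0) ≤ 1 := by
      by_cases b1 : D.Adj y v <;> by_cases b2 : D.Adj y' v <;> simp only [b1, b2, if_true, if_false] <;>
        first | omega | exact absurd ⟨b1, b2⟩ h2
    omega
  have hL := double_sum_ite_left D N N (fun y => degIn D {u, v} y)
  have hR := double_sum_ite_right D N N (fun y => degIn D {u, v} y)
  have h2 : (∑ y ∈ N, ∑ y' ∈ N, if D.Adj y y' then degIn D {u, v} y else 0) +
      (∑ y ∈ N, ∑ y' ∈ N, if D.Adj y y' then degIn D {u, v} y' else 0) ≤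
      ∑ y ∈ N, ∑ y' ∈ N, if D.Adj y y' then 2 else 0 := by
    rw [← sum_add_distrib]
    apply sum_le_sum
    intro y hy
    rw [← sum_add_distrib]
    apply sum_le_sum
    intro y' hy'
    by_cases h : D.Adj y y'
    · simp only [h, if_true]
      exact hpair y hy y' hy' h
    · simp [h]
  have h3 := double_sum_ite_left D N N (fun _ => 2)
  rw [hL, hR, h3] at h2
  rw [adjPairs_eq_sum_degIn]
  have h4 : ∑ y ∈ N, degIn D N y * 2 = 2 * ∑ y ∈ N, degIn D N y := by
    rw [mul_sum]
    apply sum_congr rfl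
    intro y _
    ring
  rw [h4] at h2
  omega

/-- `f² = f` for `f ≤ 1`. -/
theorem mul_self_of_le_one {f : ℕ} (h : f ≤ 1) : f * f = f := by
  interval_cases f <;> rfl

/-- `(1 + f + g)² = 1 + 3f + g² + 2g + 2fg` when `f² = f`. -/
theorem sq_one_add_add (f g : ℕ) (hf : f * f = f) :
    (1 + f + g) * (1 + f + g) = 1 + 3 * f + g * g + 2 * g + 2 * (f * g) := by
  nlinarith [hf]

/-- **THE ARITHMETIC OF THE CASE `u ≁ v`** (every quantity as a natural number, no subtraction):
`K = r + 4 + s` (`k = K + 3`), `m = 3K − r`, `P_u + M + α = K`, `P_v + M + β = K`, `α + β + M = r`, `c ≤ P_u`, `c ≤ P_v`,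
`1 ≤ M` ⇒ `K² + K + 10M + 3 (P_u + P_v) + 2c + P_u² + P_v² + r (s + 6) + 2 (r + s) ≤ m (K + 3)`: the gap is
`2 (min(P_u, P_v) − c) + 2 (αβ − min(α, β)) + (M − 1)(2K − M − 8)`. -/
theorem three_row_cap_arith_not_adj (K r s m M Pu Pv α β c : ℕ) (hK : K = r + 4 + s)
    (hm : m + r = 3 * K) (hα : Pu + M + α = K) (hβ : Pv + M + β = K) (hr : α + β + M = r)
    (hc1 : c ≤ Pu) (hc2 : c ≤ Pv) (hM : 1 ≤ M) :
    K * K + K + 10 * M + 3 * (Pu + Pv) + 2 * c + Pu * Pu + Pv * Pv + r * (s + 6) + 2 * (r + s) ≤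
      m * (K + 3) := by
  obtain ⟨M', rfl⟩ : ∃ M', M = M' + 1 := ⟨M - 1, by omega⟩
  obtain rfl : r = α + β + (M' + 1) := by omega
  obtain rfl : K = α + β + (M' + 1) + 4 + s := by omega
  obtain rfl : m = 2 * α + 2 * β + 2 * (M' + 1) + 12 + 3 * s := by omega
  obtain rfl : Pu = β + 4 + s := by omega
  obtain rfl : Pv = α + 4 + s := by omega
  have hprod : 0 ≤ M' * (M' + 2 * α + 2 * β + 2 * s + 1) := Nat.zero_le _
  rcases Nat.lt_or_ge α β with hab | hab
  · -- `α < β`: the term `2 α (β − 1)` and `min(P_u, P_v) = P_v`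
    obtain ⟨β', rfl⟩ : ∃ β', β = β' + 1 := ⟨β - 1, by omega⟩
    have hprod2 : 0 ≤ α * β' := Nat.zero_le _
    nlinarith [hprod, hprod2, hc2]
  · -- `β ≤ α`: the term `2 β (α − 1)` (or nothing when `β = 0`) and `min(P_u, P_v) = P_u`
    rcases Nat.eq_zero_or_pos β with hb0 | hbpos
    · subst hb0
      nlinarith [hprod, hc1]
    · obtain ⟨α', rfl⟩ : ∃ α', α = α' + 1 := ⟨α - 1, by omega⟩
      have hprod2 : 0 ≤ β * α' := Nat.zero_le _
      nlinarith [hprod, hprod2, hc1]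

/-- **THE ARITHMETIC OF THE CASE `u ∼ v`:** `K = r + 4 + s`, `m = 3K − r`, `P_u + M + α = K`, `P_v + M + β = K`,
`α + β + M = r + 1`, `c ≤ 1`, `2 ≤ M` ⇒
`K² + K + 10M + 3 (P_u + P_v) + 2c + (P_u + 1)² + (P_v + 1)² + r (s + 6) + 2 (r + s) ≤ m (K + 3)`: the gap is
`2 (1 − c) + 2 s + 2 αβ + (M − 2)(2α + 2β + 2s + M − 1) + 2`. -/
theorem three_row_cap_arith_adj (K r s m M Pu Pv α β c : ℕ) (hK : K = r + 4 + s)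
    (hm : m + r = 3 * K) (hα : Pu + M + α = K) (hβ : Pv + M + β = K) (hr : α + β + M = r + 1)
    (hc : c ≤ 1) (hM : 2 ≤ M) :
    K * K + K + 10 * M + 3 * (Pu + Pv) + 2 * c + (Pu + 1) * (Pu + 1) + (Pv + 1) * (Pv + 1) + r * (s + 6) +
        2 * (r + s) ≤ m * (K + 3) := by
  obtain ⟨M', rfl⟩ : ∃ M', M = M' + 2 := ⟨M - 2, by omega⟩
  obtain rfl : r = α + β + M' + 1 := by omega
  obtain rfl : K = α + β + M' + 5 + s := by omega
  obtain rfl : m = 2 * α + 2 * β + 2 * M' + 14 + 3 * s := by omega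
  obtain rfl : Pu = β + 3 + s := by omega
  obtain rfl : Pv = α + 3 + s := by omega
  have hprod : 0 ≤ α * β := Nat.zero_le _
  have hprod2 : 0 ≤ M' * (2 * α + 2 * β + 2 * s + M' + 1) := Nat.zero_le _
  nlinarith [hprod, hprod2, hc]

/-- The degree of a neighbour of `x` splits as `1 + degIn N + degIn R` (`N = N(x)`, `R = (N ∪ {x})ᶜ`). -/
theorem deg_eq_of_mem_nbhd (D : SimpleGraph V) [DecidableRel D.Adj] (x y : V) (hy : D.Adj x y) :
    deg D y = 1 + degIn D (univ.filter (fun w => D.Adj x w)) y +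
      degIn D (insert x (univ.filter (fun w => D.Adj x w)))ᶜ y := by
  rw [deg_eq_degIn_add_degIn_compl D (insert x (univ.filter (fun w => D.Adj x w)))]
  congr 1
  unfold degIn
  rw [filter_insert, if_pos (D.adj_symm hy), card_insert_of_notMem]
  · ring
  · intro h
    rw [mem_filter, mem_filter] at h
    exact D.irrefl h.1.2

/-- The degree of a non-neighbour `w ≠ x` of `x` splits as `degIn N + degIn R`. -/
theorem deg_eq_of_not_mem_nbhd (D : SimpleGraph V) [DecidableRel D.Adj] (x w : V) (hw : ¬ D.Adj x w) :
    deg D w = degIn D (univ.filter (fun y => D.Adj x y)) w + degIn D (insert x (univ.filter (fun y => D.Adj x y)))ᶜ w := by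
  rw [deg_eq_degIn_add_degIn_compl D (insert x (univ.filter (fun y => D.Adj x y)))]
  congr 1
  unfold degIn
  rw [filter_insert, if_neg]
  intro h
  exact hw (D.adj_symm h)

end C047

end TriangleCap

end PercRepro
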